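import Literature.NumberTheory.ConnesMoscovici2022.UVProlateBoundaryFunctional
import Literature.Analysis.FunctionSpaces.DistributionalConstancy
import Mathlib.MeasureTheory.Integral.IntervalIntegral.LebesgueDifferentiationThm

/-!
# RH-FREE. Connes–Moscovici 2022, §1: regularity of GENERAL elements of `dom W_max`

LINE 1 FRAMING: RH-FREE corpus literature (cell rh-crit, C1 Connes–Consani/Moscovici corpus, row
O2 `UVProlateSpectrum`; one-dimensional «weak ⇒ classical» bookkeeping for the prolate wave operator
`W_λ = −∂ₓ(λ² − x²)∂ₓ + (2πλx)²`).  bears_on: W-C/W-P only (sequel material, no leaf role in any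
route).  WHAT THIS IS NOT: nothing here bears on the truth of RH; no statement about zeta zeros; no
definition, no named fact (theorems only, net debt 0).

## What is proved (the «enabling lemma» for Thm 1.6 (ii)–(iv) / Lemma 1.5 asked for on the cell board)

For `λ > 0` and an ARBITRARY `ξ ∈ dom W_max` (so `η := W_max ξ ∈ L²(ℝ)` is arbitrary — `ξ` need not
be an eigenvector), writing `p = λ² − x²`, `q = (2πλ)²x²`, `h := qξ − η ∈ L¹_loc(ℝ)`:

* `exists_ae_eq_primitive_of_Icc_subset` — on every compact interval `[α, β]` avoiding `±λ` and
  every base point `b ∈ [α, β]`, `ξ` agrees a.e. on `(α, β)` with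
  `x ↦ k + ∫_b^x (F_b(t) + m)/p(t) dt`, `F_b(t) = ∫_b^t h`, for some constants `m, k`
  (t8's weak first-order equation `integral_deriv_mul_eq_of_mem_prolateMax` + du Bois-Reymond);
  the constants are unique (`constants_unique`), hence the same on every larger interval, hence
  (`ae_eq_primitive_on_iUnion`) on a whole component of `ℝ ∖ {±λ}`;
* `exists_regular_repr` — **the packaged statement**: there is `g : ℝ → ℂ` with `ξ = g` a.e.,
  `g ∈ C¹(ℝ ∖ {±λ})`, and on each component `p g′` is a primitive of `q g − η`:
  `p(y)g′(y) − p(x)g′(x) = ∫_x^y (q g − η)` whenever `[x, y] ⊆ ℝ ∖ {±λ}` (so `p g′` is locally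
  absolutely continuous there with `(p g′)′ = q g − η` a.e. — also exported in `HasDerivAt` form),
  and `p g′` has one-sided limits at `±λ` from each side (the boundary values of Lemma 1.2 (i));
* `eqOn_of_ae_eq_of_continuousOn` — any two representatives continuous off `±λ` agree off `±λ`.

Printed source of the mechanism: A. Connes, H. Moscovici, *The UV prolate spectrum matches the zeros
of zeta*, PNAS 119 (2022) [ConnesMoscovici2022] = arXiv:2112.05500v1, proof of Lemma 2.2
(chunk p0004:L58–L90: «the distribution `p∂ξ` coincides with a continuous function `f = f₁ + s`»);
the one-dimensional du Bois-Reymond lemma is Brezis 2011, Lemma 8.1 / Cor. 8.10 (tree: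
`Literature.Analysis.FunctionSpaces.ae_eq_const_of_forall_setIntegral_deriv_mul_eq_zero`, used here
through its complex-valued corollaries `exists_ae_eq_const_of_forall_integral_deriv_mul_eq_zero` /
`exists_ae_eq_primitive_add_const`).  Deviation from print (made explicit): the paper states the
regularity near `±λ` only; here it is recorded on all of `ℝ ∖ {±λ}` by exhausting each of the three
components with compact intervals, the constants being pinned by their values at a base point.

0 `def`s, 0 new facts, no `sorry`; cell rh-crit seat cc-t6 g4 (cc-lead R120 (5)).
-/

noncomputable section

open Complex Set MeasureTheory Filter intervalIntegral
open scoped Real Topology ContDiff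

namespace Literature.NumberTheory.ConnesMoscovici2022

open Literature.NumberTheory.ConnesConsani2021 Literature.NumberTheory.ConnesConsani2024
  Literature.Analysis.FunctionSpaces

/-! ## §1. Complex-valued du Bois-Reymond lemmas on a bounded open interval -/

section DuBoisReymond

variable {α β : ℝ}

/-- A test function on `(α, β)` times a function integrable on `(α, β)` is integrable on `ℝ`
(the product vanishes off `(α, β)`). [folklore] -/
private theorem integrable_test_mul {Θ : ℝ → ℝ} (hΘ : Continuous Θ) (hΘc : HasCompactSupport Θ)
    (hΘs : Function.support Θ ⊆ Ioo α β) {u : ℝ → ℂ} (hu : IntegrableOn u (Ioo α β)) :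
    Integrable (fun x ↦ (Θ x : ℂ) * u x) := by
  obtain ⟨C, hC⟩ := (hΘc.comp_left Complex.ofReal_zero).exists_bound_of_continuous
    (Complex.continuous_ofReal.comp hΘ)
  have hIoo : IntegrableOn (fun x ↦ (Θ x : ℂ) * u x) (Ioo α β) :=
    Integrable.bdd_mul hu (Complex.continuous_ofReal.comp hΘ).aestronglyMeasurable
      (Eventually.of_forall fun x ↦ hC x)
  refine hIoo.integrable_of_forall_notMem_eq_zero fun x hx ↦ ?_
  have : Θ x = 0 := by
    by_contra h
    exact hx (hΘs (Function.mem_support.mpr h))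
  simp [this]

/-- **du Bois-Reymond, complex-valued**: if `u` is integrable on `(α, β)` and `∫ Θ′ u = 0` for every
test function `Θ` supported in `(α, β)`, then `u` is a.e. constant on `(α, β)` (real and imaginary
parts separately, by the tree's real lemma). [cite: Brezis2011, Lemma 8.1] -/
theorem exists_ae_eq_const_of_forall_integral_deriv_mul_eq_zero {u : ℝ → ℂ}
    (hu : IntegrableOn u (Ioo α β))
    (h : ∀ Θ : ℝ → ℝ, ContDiff ℝ ∞ Θ → HasCompactSupport Θ → tsupport Θ ⊆ Ioo α β →
      ∫ x, ((deriv Θ x : ℝ) : ℂ) * u x = 0) :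
    ∃ k : ℂ, ∀ᵐ x ∂(volume.restrict (Ioo α β)), u x = k := by
  -- the set-integral form of the hypothesis, and its real and imaginary parts
  have hset : ∀ Θ : ℝ → ℝ, ContDiff ℝ ∞ Θ → HasCompactSupport Θ → tsupport Θ ⊆ Ioo α β →
      ∫ x in Ioo α β, ((deriv Θ x : ℝ) : ℂ) * u x = 0 := by
    intro Θ hΘ hΘc hΘs
    rw [setIntegral_eq_integral_of_forall_compl_eq_zero fun x hx ↦ ?_, h Θ hΘ hΘc hΘs]
    have : deriv Θ x = 0 := by
      by_contra hne
      exact hx (hΘs (support_deriv_subset (Function.mem_support.mpr hne)))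
    simp [this]
  have hint : ∀ Θ : ℝ → ℝ, ContDiff ℝ ∞ Θ → HasCompactSupport Θ → tsupport Θ ⊆ Ioo α β →
      Integrable (fun x ↦ ((deriv Θ x : ℝ) : ℂ) * u x) (volume.restrict (Ioo α β)) := by
    intro Θ hΘ hΘc hΘs
    exact (integrable_test_mul (hΘ.continuous_deriv (by simp)) hΘc.deriv
      (support_deriv_subset.trans hΘs) hu).integrableOn
  have hre : ∀ Θ : ℝ → ℝ, ContDiff ℝ ∞ Θ → HasCompactSupport Θ → tsupport Θ ⊆ Ioo α β →
      ∫ x in Ioo α β, deriv Θ x * (u x).re = 0 := by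
    intro Θ hΘ hΘc hΘs
    have h1 : ∫ x in Ioo α β, deriv Θ x * (u x).re =
        ∫ x in Ioo α β, RCLike.re (((deriv Θ x : ℝ) : ℂ) * u x) := by
      congr 1; funext x; simp
    rw [h1, integral_re (hint Θ hΘ hΘc hΘs), hset Θ hΘ hΘc hΘs]; simp
  have him : ∀ Θ : ℝ → ℝ, ContDiff ℝ ∞ Θ → HasCompactSupport Θ → tsupport Θ ⊆ Ioo α β →
      ∫ x in Ioo α β, deriv Θ x * (u x).im = 0 := by
    intro Θ hΘ hΘc hΘs
    have h1 : ∫ x in Ioo α β, deriv Θ x * (u x).im =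
        ∫ x in Ioo α β, RCLike.im (((deriv Θ x : ℝ) : ℂ) * u x) := by
      congr 1; funext x; simp
    rw [h1, integral_im (hint Θ hΘ hΘc hΘs), hset Θ hΘ hΘc hΘs]; simp
  obtain ⟨c₁, hc₁⟩ := ae_eq_const_of_forall_setIntegral_deriv_mul_eq_zero hu.re hre
  obtain ⟨c₂, hc₂⟩ := ae_eq_const_of_forall_setIntegral_deriv_mul_eq_zero hu.im him
  refine ⟨⟨c₁, c₂⟩, ?_⟩
  filter_upwards [hc₁, hc₂] with x h1 h2
  exact Complex.ext h1 h2

/-- **du Bois-Reymond with a continuous right-hand side, complex-valued**: if `u` is integrable on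
`(α, β)`, `w` is continuous on `[α, β]`, and `∫ Θ′ u = −∫ Θ w` for every test function `Θ` on
`(α, β)`, then `u` agrees a.e. on `(α, β)` with a primitive of `w` plus a constant.
[cite: Brezis2011, Lemma 8.1 and Cor. 8.10] -/
theorem exists_ae_eq_primitive_add_const (hαβ : α < β) {u w : ℝ → ℂ}
    (hu : IntegrableOn u (Ioo α β)) (hw : ContinuousOn w (Icc α β)) {x₁ : ℝ} (hx₁ : x₁ ∈ Icc α β)
    (h : ∀ Θ : ℝ → ℝ, ContDiff ℝ ∞ Θ → HasCompactSupport Θ → tsupport Θ ⊆ Ioo α β →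
      ∫ x, ((deriv Θ x : ℝ) : ℂ) * u x = -∫ x, (Θ x : ℂ) * w x) :
    ∃ k : ℂ, ∀ᵐ x ∂(volume.restrict (Ioo α β)), u x = (∫ t in x₁..x, w t) + k := by
  set G : ℝ → ℂ := fun x ↦ ∫ t in x₁..x, w t with hG
  -- `G` is continuous on `[α, β]` and differentiable on `(α, β)` with derivative `w`
  have hGd : ∀ x ∈ Ioo α β, HasDerivAt G (w x) x := by
    intro x hx
    have hsub : uIcc x₁ x ⊆ Icc α β := uIcc_subset_Icc hx₁ ⟨hx.1.le, hx.2.le⟩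
    exact integral_hasDerivAt_right ((hw.mono hsub).intervalIntegrable)
      ((hw.mono Ioo_subset_Icc_self).stronglyMeasurableAtFilter isOpen_Ioo x hx)
      (hw.continuousAt (Icc_mem_nhds hx.1 hx.2))
  have hGc : ContinuousOn G (Icc α β) := by
    have hi : IntervalIntegrable w volume α β :=
      (hw.mono (by rw [uIcc_of_le hαβ.le])).intervalIntegrable
    have hc := continuousOn_primitive_interval' (μ := volume) hi
      (a := x₁) (by rwa [uIcc_of_le hαβ.le])
    rwa [uIcc_of_le hαβ.le] at hc
  have hGi : IntegrableOn G (Ioo α β) :=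
    (hGc.integrableOn_compact isCompact_Icc).mono_set Ioo_subset_Icc_self
  -- integration by parts against a test function: `∫ Θ′ G = −∫ Θ w`
  have hparts : ∀ Θ : ℝ → ℝ, ContDiff ℝ ∞ Θ → HasCompactSupport Θ → tsupport Θ ⊆ Ioo α β →
      ∫ x, ((deriv Θ x : ℝ) : ℂ) * G x = -∫ x, (Θ x : ℂ) * w x := by
    intro Θ hΘ hΘc hΘs
    have hΘd : ∀ x, HasDerivAt Θ (deriv Θ x) x := fun x ↦
      (hΘ.differentiable (by simp) x).hasDerivAt
    have hΘ'c : Continuous (deriv Θ) := hΘ.continuous_deriv (by simp)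
    -- the product `Θ G` and its derivative
    set P : ℝ → ℂ := fun x ↦ (Θ x : ℂ) * G x with hP
    set P' : ℝ → ℂ := fun x ↦ ((deriv Θ x : ℝ) : ℂ) * G x + (Θ x : ℂ) * w x with hP'
    have hzero : ∀ x, x ∉ tsupport Θ → Θ x = 0 ∧ deriv Θ x = 0 := fun x hx ↦
      ⟨image_eq_zero_of_notMem_tsupport hx,
        Function.notMem_support.mp fun h' ↦ hx (support_deriv_subset h')⟩
    have hPd : ∀ x, HasDerivAt P (P' x) x := by
      intro x
      by_cases hx : x ∈ tsupport Θ
      · have hxJ := hΘs hx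
        have h1 : HasDerivAt (fun y ↦ (Θ y : ℂ)) ((deriv Θ x : ℝ) : ℂ) x :=
          (hΘd x).ofReal_comp
        have h2 : HasDerivAt (fun y ↦ (Θ y : ℂ) * G y)
            (((deriv Θ x : ℝ) : ℂ) * G x + (Θ x : ℂ) * w x) x := h1.mul (hGd x hxJ)
        simp only [hP, hP']
        exact h2
      · -- `P ≡ 0` near `x`
        have hnhds : ∀ᶠ y in 𝓝 x, P y = 0 := by
          filter_upwards [(isClosed_tsupport Θ).isOpen_compl.mem_nhds hx] with y hy
          simp [hP, (hzero y hy).1]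
        have h0 : HasDerivAt P 0 x := by
          have := (hasDerivAt_const x (0 : ℂ)).congr_of_eventuallyEq hnhds
          simpa using this
        have : P' x = 0 := by simp [hP', (hzero x hx).1, (hzero x hx).2]
        rw [this]; exact h0
    -- integrability of `P`, `Θ′ G`, `Θ w`
    have hPi : Integrable P :=
      integrable_test_mul hΘ.continuous hΘc (subset_tsupport _ |>.trans hΘs) hGi
    have h1i : Integrable (fun x ↦ ((deriv Θ x : ℝ) : ℂ) * G x) :=
      integrable_test_mul hΘ'c hΘc.deriv (support_deriv_subset.trans hΘs) hGi
    have h2i : Integrable (fun x ↦ (Θ x : ℂ) * w x) :=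
      integrable_test_mul hΘ.continuous hΘc (subset_tsupport _ |>.trans hΘs)
        ((hw.integrableOn_compact isCompact_Icc).mono_set Ioo_subset_Icc_self)
    have hP'i : Integrable P' := h1i.add h2i
    have htot : ∫ x, P' x = 0 := integral_eq_zero_of_hasDerivAt_of_integrable hPd hP'i hPi
    rw [hP', integral_add h1i h2i] at htot
    linear_combination htot
  -- `v = u − G` has vanishing distributional derivative
  obtain ⟨k, hk⟩ := exists_ae_eq_const_of_forall_integral_deriv_mul_eq_zero (hu.sub hGi)
    (fun Θ hΘ hΘc hΘs ↦ by
      have h1i : Integrable (fun x ↦ ((deriv Θ x : ℝ) : ℂ) * u x) :=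
        integrable_test_mul (hΘ.continuous_deriv (by simp)) hΘc.deriv
          (support_deriv_subset.trans hΘs) hu
      have h2i : Integrable (fun x ↦ ((deriv Θ x : ℝ) : ℂ) * G x) :=
        integrable_test_mul (hΘ.continuous_deriv (by simp)) hΘc.deriv
          (support_deriv_subset.trans hΘs) hGi
      simp only [Pi.sub_apply, mul_sub]
      rw [integral_sub h1i h2i, h Θ hΘ hΘc hΘs, hparts Θ hΘ hΘc hΘs, sub_self])
  exact ⟨k, by filter_upwards [hk] with x hx; rw [← hx]; simp [hG]⟩

end DuBoisReymond


/-! ## §2. The local regularity of `ξ ∈ dom W_max` on a compact interval avoiding `±λ` -/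

section Local

variable {lam : ℝ}

/-- `h = qξ − W_max ξ` is locally integrable (`ξ, W_max ξ ∈ L²(ℝ)`, `q` continuous).
[cite: ConnesMoscovici2022, proof of Lemma 1.2 (= arXiv Lemma 2.2, chunk p0004:L72–L74: «the restriction of ξ₁ − η to V belongs to L²(V) ⊂ L¹(V) and the function f₁(x) = −∫_b^x (ξ₁ − η)(t)dt is continuous»)] -/
theorem locallyIntegrable_qMul_sub (ξ : (prolateMax lam).domain) :
    LocallyIntegrable (fun t ↦ qCoeff lam t * (ξ : L2R) t - (prolateMax lam ξ : L2R) t) := by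
  have hu : LocallyIntegrable (fun t ↦ ((ξ : L2R) : ℝ → ℂ) t) :=
    (Lp.memLp (ξ : L2R)).locallyIntegrable (by norm_num)
  have he : LocallyIntegrable (fun t ↦ ((prolateMax lam ξ : L2R) : ℝ → ℂ) t) :=
    (Lp.memLp (prolateMax lam ξ : L2R)).locallyIntegrable (by norm_num)
  have hq : Continuous (qCoeff lam) := by unfold qCoeff; fun_prop
  have hqu : LocallyIntegrable (fun t ↦ qCoeff lam t * (ξ : L2R) t) := by
    rw [← locallyIntegrableOn_univ] at hu ⊢
    exact hu.continuousOn_mul hq.continuousOn isClosed_univ.isLocallyClosed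
  exact hqu.sub he

/-- Interval integrability of `h = qξ − W_max ξ`.
[cite: ConnesMoscovici2022, proof of Lemma 1.2 (= arXiv Lemma 2.2, chunk p0004:L72–L74: «the restriction of ξ₁ − η to V belongs to L²(V) ⊂ L¹(V) and the function f₁(x) = −∫_b^x (ξ₁ − η)(t)dt is continuous»)] -/
theorem intervalIntegrable_qMul_sub (ξ : (prolateMax lam).domain) (x y : ℝ) :
    IntervalIntegrable (fun t ↦ qCoeff lam t * (ξ : L2R) t - (prolateMax lam ξ : L2R) t)
      volume x y :=
  (intervalIntegrable_iff').2
    ((locallyIntegrable_qMul_sub ξ).integrableOn_isCompact isCompact_uIcc)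

/-- The primitive `F_b(x) = ∫_b^x h` is continuous on `ℝ` («f₁ is continuous»).
[cite: ConnesMoscovici2022, proof of Lemma 1.2 (= arXiv Lemma 2.2, chunk p0004:L72–L74: «the restriction of ξ₁ − η to V belongs to L²(V) ⊂ L¹(V) and the function f₁(x) = −∫_b^x (ξ₁ − η)(t)dt is continuous»)] -/
theorem continuous_primitive_qMul_sub (ξ : (prolateMax lam).domain) (b : ℝ) :
    Continuous fun x ↦ ∫ t in b..x,
      (qCoeff lam t * (ξ : L2R) t - (prolateMax lam ξ : L2R) t) :=
  continuous_primitive (intervalIntegrable_qMul_sub ξ) b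

/-- `ξ ∈ L²(ℝ)` is integrable on every bounded interval. [folklore] -/
private theorem integrableOn_Ioo_coe (ξ : (prolateMax lam).domain) (α β : ℝ) :
    IntegrableOn (fun t ↦ ((ξ : L2R) : ℝ → ℂ) t) (Ioo α β) :=
  ((((Lp.memLp (ξ : L2R)).locallyIntegrable (by norm_num)).integrableOn_isCompact
    isCompact_Icc).mono_set Ioo_subset_Icc_self)

/-- `p = λ² − x²` does not vanish off `±λ`. [folklore] -/
private theorem sq_sub_sq_ne_zero_of_mem {x : ℝ} (hx : x ∈ {x : ℝ | x ≠ lam ∧ x ≠ -lam}) :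
    lam ^ 2 - x ^ 2 ≠ 0 := by
  intro h0
  have : (x - lam) * (x + lam) = 0 := by nlinarith [h0]
  rcases mul_eq_zero.mp this with h | h
  · exact hx.1 (by linarith)
  · exact hx.2 (by linarith)

/-- `pCoeff` does not vanish off `±λ`. [folklore] -/
private theorem pCoeff_ne_zero_of_mem {x : ℝ} (hx : x ∈ {x : ℝ | x ≠ lam ∧ x ≠ -lam}) :
    pCoeff lam x ≠ 0 := by
  rw [pCoeff]; exact_mod_cast sq_sub_sq_ne_zero_of_mem hx

/-- Continuity of `pCoeff`. [folklore] -/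
private theorem continuous_pCoeff (lam : ℝ) : Continuous (pCoeff lam) := by
  unfold pCoeff; fun_prop

/-- On an order-connected set `J` avoiding `±λ` and containing `b`, the candidate representative
`Φ(x) = k + ∫_b^x (F_b + m)/p` has derivative `(F_b(x) + m)/p(x)` at every interior point of `J`.
[cite: ConnesMoscovici2022, proof of Lemma 1.2 (= arXiv Lemma 2.2, chunk p0004:L80–L90)] -/
theorem hasDerivAt_primitive (ξ : (prolateMax lam).domain) {J : Set ℝ} (hJo : IsOpen J)
    (hJc : J.OrdConnected) (hJU : J ⊆ {x | x ≠ lam ∧ x ≠ -lam}) {b : ℝ} (hb : b ∈ J) (m k : ℂ)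
    {x : ℝ} (hx : x ∈ J) :
    HasDerivAt
      (fun y ↦ (∫ t in b..y, ((∫ s in b..t,
          (qCoeff lam s * (ξ : L2R) s - (prolateMax lam ξ : L2R) s)) + m) / pCoeff lam t) + k)
      (((∫ s in b..x, (qCoeff lam s * (ξ : L2R) s - (prolateMax lam ξ : L2R) s)) + m) /
        pCoeff lam x) x := by
  set w : ℝ → ℂ := fun t ↦ ((∫ s in b..t,
      (qCoeff lam s * (ξ : L2R) s - (prolateMax lam ξ : L2R) s)) + m) / pCoeff lam t with hw
  have hwc : ContinuousOn w J :=
    ((continuous_primitive_qMul_sub ξ b).continuousOn.add continuousOn_const).div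
      (continuous_pCoeff lam).continuousOn fun t ht ↦ pCoeff_ne_zero_of_mem (hJU ht)
  have h1 : HasDerivAt (fun y ↦ ∫ t in b..y, w t) (w x) x :=
    integral_hasDerivAt_right ((hwc.mono (hJc.uIcc_subset hb hx)).intervalIntegrable)
      (hwc.stronglyMeasurableAtFilter hJo x hx) (hwc.continuousAt (hJo.mem_nhds hx))
  exact h1.add_const k

/-- Hence `Φ ∈ C¹(J)` with `p Φ′ = F_b + m` on `J`.
[cite: ConnesMoscovici2022, proof of Lemma 1.2 (= arXiv Lemma 2.2, chunk p0004:L80–L90)] -/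
theorem contDiffOn_primitive (ξ : (prolateMax lam).domain) {J : Set ℝ} (hJo : IsOpen J)
    (hJc : J.OrdConnected) (hJU : J ⊆ {x | x ≠ lam ∧ x ≠ -lam}) {b : ℝ} (hb : b ∈ J) (m k : ℂ) :
    ContDiffOn ℝ 1
      (fun y ↦ (∫ t in b..y, ((∫ s in b..t,
          (qCoeff lam s * (ξ : L2R) s - (prolateMax lam ξ : L2R) s)) + m) / pCoeff lam t) + k)
      J ∧
    ∀ x ∈ J, pCoeff lam x * deriv
      (fun y ↦ (∫ t in b..y, ((∫ s in b..t,
          (qCoeff lam s * (ξ : L2R) s - (prolateMax lam ξ : L2R) s)) + m) / pCoeff lam t) + k) x =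
      (∫ s in b..x, (qCoeff lam s * (ξ : L2R) s - (prolateMax lam ξ : L2R) s)) + m := by
  set w : ℝ → ℂ := fun t ↦ ((∫ s in b..t,
      (qCoeff lam s * (ξ : L2R) s - (prolateMax lam ξ : L2R) s)) + m) / pCoeff lam t with hw
  have hwc : ContinuousOn w J :=
    ((continuous_primitive_qMul_sub ξ b).continuousOn.add continuousOn_const).div
      (continuous_pCoeff lam).continuousOn fun t ht ↦ pCoeff_ne_zero_of_mem (hJU ht)
  have hd : ∀ x ∈ J, HasDerivAt (fun y ↦ (∫ t in b..y, w t) + k) (w x) x :=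
    fun x hx ↦ hasDerivAt_primitive ξ hJo hJc hJU hb m k hx
  have hderiv : ∀ x ∈ J, deriv (fun y ↦ (∫ t in b..y, w t) + k) x = w x :=
    fun x hx ↦ (hd x hx).deriv
  refine ⟨?_, fun x hx ↦ ?_⟩
  · rw [show (1 : WithTop ℕ∞) = 0 + 1 from (zero_add 1).symm,
      contDiffOn_succ_iff_deriv_of_isOpen hJo]
    refine ⟨fun x hx ↦ (hd x hx).differentiableAt.differentiableWithinAt, by simp, ?_⟩
    exact contDiffOn_zero.2 (hwc.congr fun x hx ↦ hderiv x hx)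
  · rw [hderiv x hx, hw]
    field_simp [pCoeff_ne_zero_of_mem (hJU hx)]

end Local

section LocalAE

variable {lam : ℝ}

/-- RH-FREE (PROVED). **Local regularity of a general element of `dom W_max`.** On a compact interval
`[α, β]` avoiding `±λ`, with any base point `b ∈ [α, β]`: `ξ` agrees a.e. on `(α, β)` with
`x ↦ k + ∫_b^x (F_b(t) + m)/p(t) dt`, `F_b(t) = ∫_b^t (qξ − W_max ξ)`, for some constants `m, k ∈ ℂ`
(t8's weak first-order equation `p ξ′ = F + m` in `𝒟′(α, β)` + du Bois-Reymond).
[cite: ConnesMoscovici2022, proof of Lemma 1.2 (= arXiv Lemma 2.2, chunk p0004:L64–L90)] -/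
theorem exists_ae_eq_primitive_of_Icc_subset {α β : ℝ} (hαβ : α < β)
    (hU : Icc α β ⊆ {x | x ≠ lam ∧ x ≠ -lam}) (ξ : (prolateMax lam).domain)
    {b : ℝ} (hb : b ∈ Icc α β) :
    ∃ m k : ℂ, ∀ᵐ x ∂(volume.restrict (Ioo α β)),
      ((ξ : L2R) : ℝ → ℂ) x =
        (∫ t in b..x, ((∫ s in b..t,
          (qCoeff lam s * (ξ : L2R) s - (prolateMax lam ξ : L2R) s)) + m) / pCoeff lam t) + k := by
  have hp : ∀ x ∈ Icc α β, lam ^ 2 - x ^ 2 ≠ 0 := fun x hx ↦ sq_sub_sq_ne_zero_of_mem (hU hx)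
  obtain ⟨φ₂, hφ₂, hφ₂c, hφ₂s, hφ₂i⟩ := exists_contDiff_tsupport_subset_Ioo_integral_eq_one hαβ
  set hf : ℝ → ℂ := fun s ↦ qCoeff lam s * (ξ : L2R) s - (prolateMax lam ξ : L2R) s with hhf
  set Fα : ℝ → ℂ := fun x ↦ ∫ t in α..x, hf t with hFα
  set M : ℂ := -(∫ y, (ξ : L2R) y * ((deriv (fun z ↦ (lam ^ 2 - z ^ 2) * φ₂ z) y : ℝ) : ℂ)) -
    ∫ y, (φ₂ y : ℂ) * Fα y with hM
  set w : ℝ → ℂ := fun x ↦ (Fα x + M) / ((lam ^ 2 - x ^ 2 : ℝ) : ℂ) with hw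
  have hweak : ∀ Θ : ℝ → ℝ, ContDiff ℝ ∞ Θ → HasCompactSupport Θ → tsupport Θ ⊆ Ioo α β →
      ∫ x, ((deriv Θ x : ℝ) : ℂ) * (ξ : L2R) x = -∫ x, (Θ x : ℂ) * w x :=
    fun Θ hΘ hΘc hΘs ↦ integral_deriv_mul_eq_of_mem_prolateMax hαβ
      (fun x hx ↦ hp x (Ioo_subset_Icc_self hx)) ξ hφ₂ hφ₂c hφ₂s hφ₂i hΘ hΘc hΘs
  have hFc : Continuous Fα := continuous_primitive_qMul_sub ξ α
  have hwc : ContinuousOn w (Icc α β) := by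
    refine (hFc.continuousOn.add continuousOn_const).div (by fun_prop) fun x hx ↦ ?_
    exact_mod_cast hp x hx
  obtain ⟨k, hk⟩ := exists_ae_eq_primitive_add_const hαβ (integrableOn_Ioo_coe ξ α β) hwc hb hweak
  refine ⟨M + ∫ s in α..b, hf s, k, ?_⟩
  filter_upwards [hk] with x hx
  rw [hx]
  congr 1
  refine integral_congr fun t _ ↦ ?_
  have hsplit : Fα t = (∫ s in α..b, hf s) + ∫ s in b..t, hf s :=
    (integral_add_adjacent_intervals (intervalIntegrable_qMul_sub ξ α b)
      (intervalIntegrable_qMul_sub ξ b t)).symm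
  simp only [hw, pCoeff, hsplit]
  ring

/-- RH-FREE (PROVED). **The constants are pinned by the base point**: if `ξ` agrees a.e. near `b` with
`Φ_{m,k}` and with `Φ_{m',k'}` (on two open intervals containing `b`, both avoiding `±λ`), then
`m = m'` and `k = k'` (value and derivative at `b` of the continuous representatives).
[cite: ConnesMoscovici2022, proof of Lemma 1.2 (= arXiv Lemma 2.2, chunk p0004:L80–L86: «the distribution p(x)∂ₓξ coincides with the function f := f₁ + s on V»)]
[cite: Brezis2011, Cor. 8.10] -/
theorem constants_unique (ξ : (prolateMax lam).domain) {α β α' β' b : ℝ} (hb : b ∈ Ioo α β)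
    (hb' : b ∈ Ioo α' β') (hU : Ioo α β ⊆ {x | x ≠ lam ∧ x ≠ -lam}) {m k m' k' : ℂ}
    (h : ∀ᵐ x ∂(volume.restrict (Ioo α β)), ((ξ : L2R) : ℝ → ℂ) x =
      (∫ t in b..x, ((∫ s in b..t,
        (qCoeff lam s * (ξ : L2R) s - (prolateMax lam ξ : L2R) s)) + m) / pCoeff lam t) + k)
    (h' : ∀ᵐ x ∂(volume.restrict (Ioo α' β')), ((ξ : L2R) : ℝ → ℂ) x =
      (∫ t in b..x, ((∫ s in b..t,
        (qCoeff lam s * (ξ : L2R) s - (prolateMax lam ξ : L2R) s)) + m') / pCoeff lam t) + k') :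
    m = m' ∧ k = k' := by
  set Φ : ℂ → ℂ → ℝ → ℂ := fun m k x ↦ (∫ t in b..x, ((∫ s in b..t,
      (qCoeff lam s * (ξ : L2R) s - (prolateMax lam ξ : L2R) s)) + m) / pCoeff lam t) + k with hΦ
  -- the common open interval `J ∋ b`
  set J : Set ℝ := Ioo (max α α') (min β β') with hJ
  have hbJ : b ∈ J := ⟨max_lt hb.1 hb'.1, lt_min hb.2 hb'.2⟩
  have hJ1 : J ⊆ Ioo α β := Ioo_subset_Ioo (le_max_left _ _) (min_le_left _ _)
  have hJ2 : J ⊆ Ioo α' β' := Ioo_subset_Ioo (le_max_right _ _) (min_le_right _ _)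
  have hJU : J ⊆ {x | x ≠ lam ∧ x ≠ -lam} := hJ1.trans hU
  have hd : ∀ x ∈ J, HasDerivAt (Φ m k) _ x := fun x hx ↦
    hasDerivAt_primitive ξ isOpen_Ioo ordConnected_Ioo hJU hbJ m k hx
  have hd' : ∀ x ∈ J, HasDerivAt (Φ m' k') _ x := fun x hx ↦
    hasDerivAt_primitive ξ isOpen_Ioo ordConnected_Ioo hJU hbJ m' k' hx
  -- the two continuous representatives agree on `J`
  have hae : (Φ m k) =ᵐ[volume.restrict J] (Φ m' k') := by
    have h1 := ae_restrict_of_ae_restrict_of_subset hJ1 h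
    have h2 := ae_restrict_of_ae_restrict_of_subset hJ2 h'
    filter_upwards [h1, h2] with x hx1 hx2
    simp only [hΦ]
    rw [← hx1, ← hx2]
  have heq : EqOn (Φ m k) (Φ m' k') J :=
    Measure.eqOn_open_of_ae_eq hae isOpen_Ioo
      (fun x hx ↦ (hd x hx).continuousAt.continuousWithinAt)
      (fun x hx ↦ (hd' x hx).continuousAt.continuousWithinAt)
  have hk : k = k' := by simpa [hΦ] using heq hbJ
  refine ⟨?_, hk⟩
  -- derivatives at `b`
  have hev : Φ m k =ᶠ[𝓝 b] Φ m' k' := heq.eventuallyEq_of_mem (isOpen_Ioo.mem_nhds hbJ)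
  have h1 := ((hd b hbJ).congr_of_eventuallyEq hev.symm).unique (hd' b hbJ)
  have hpb : pCoeff lam b ≠ 0 := pCoeff_ne_zero_of_mem (hJU hbJ)
  simp only [integral_same, zero_add] at h1
  field_simp at h1
  exact h1

/-- RH-FREE (PROVED). **Regularity on a whole component** exhausted by compact intervals: if the open
intervals `(a n, c n)` (closures avoiding `±λ`) all contain the base point `b`, then ONE pair of
constants `m, k` serves a.e. on their union.
[cite: ConnesMoscovici2022, proof of Lemma 1.2 (= arXiv Lemma 2.2, chunk p0004:L80–L86: «the distribution p(x)∂ₓξ coincides with the function f := f₁ + s on V»)] -/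
theorem ae_eq_primitive_on_iUnion (ξ : (prolateMax lam).domain) {a c : ℕ → ℝ} {b : ℝ}
    (hU : ∀ n, Icc (a n) (c n) ⊆ {x | x ≠ lam ∧ x ≠ -lam}) (hb : ∀ n, b ∈ Ioo (a n) (c n)) :
    ∃ m k : ℂ, ∀ᵐ x ∂(volume.restrict (⋃ n, Ioo (a n) (c n))),
      ((ξ : L2R) : ℝ → ℂ) x =
        (∫ t in b..x, ((∫ s in b..t,
          (qCoeff lam s * (ξ : L2R) s - (prolateMax lam ξ : L2R) s)) + m) / pCoeff lam t) + k := by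
  have hac : ∀ n, a n < c n := fun n ↦ (hb n).1.trans (hb n).2
  choose m k hmk using fun n ↦ exists_ae_eq_primitive_of_Icc_subset (hac n) (hU n) ξ
    (Ioo_subset_Icc_self (hb n))
  refine ⟨m 0, k 0, ?_⟩
  rw [ae_restrict_iUnion_iff]
  intro n
  obtain ⟨hm, hk⟩ := constants_unique ξ (hb n) (hb 0)
    ((Ioo_subset_Icc_self).trans (hU n)) (hmk n) (hmk 0)
  rw [← hm, ← hk]
  exact hmk n

end LocalAE

/-! ## §3. The three components of `ℝ ∖ {±λ}` and the packaged representative -/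

section Global

variable {lam : ℝ}

/-- `ℝ ∖ {±λ}` is open. [folklore] -/
private theorem isOpen_ne_lam_ne_neg_lam (lam : ℝ) : IsOpen {x : ℝ | x ≠ lam ∧ x ≠ -lam} :=
  isOpen_ne.and isOpen_ne

/-- RH-FREE (PROVED). **Uniqueness of the regular representative**: two representatives of the same
a.e. class that are continuous off `±λ` agree off `±λ`.
[cite: ConnesMoscovici2022, proof of Lemma 1.2 (= arXiv Lemma 2.2, chunk p0004:L80–L86: «the distribution p(x)∂ₓξ coincides with the function f := f₁ + s on V»)] -/
theorem eqOn_of_ae_eq_of_continuousOn {g₁ g₂ : ℝ → ℂ} (h : g₁ =ᵐ[volume] g₂)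
    (h₁ : ContinuousOn g₁ {x | x ≠ lam ∧ x ≠ -lam})
    (h₂ : ContinuousOn g₂ {x | x ≠ lam ∧ x ≠ -lam}) :
    EqOn g₁ g₂ {x | x ≠ lam ∧ x ≠ -lam} :=
  Measure.eqOn_open_of_ae_eq (ae_restrict_of_ae h) (isOpen_ne_lam_ne_neg_lam lam) h₁ h₂

/-- The middle component `(−λ, λ)` is exhausted by `(−λ + λ/(n+2), λ − λ/(n+2))`. [folklore] -/
private theorem Ioo_subset_iUnion_middle (lam : ℝ) :
    Ioo (-lam) lam ⊆ ⋃ n : ℕ, Ioo (-lam + lam / (n + 2)) (lam - lam / (n + 2)) := by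
  intro x hx
  have hδ : 0 < min (x + lam) (lam - x) := lt_min (by linarith [hx.1]) (by linarith [hx.2])
  obtain ⟨n, hn⟩ := exists_nat_gt (lam / min (x + lam) (lam - x))
  refine mem_iUnion.2 ⟨n, ?_⟩
  have hn2 : (0 : ℝ) < n + 2 := by positivity
  have hlt : lam / (n + 2) < min (x + lam) (lam - x) := by
    rw [div_lt_iff₀ hn2]
    have := (div_lt_iff₀ hδ).1 hn
    nlinarith
  constructor
  · linarith [min_le_left (x + lam) (lam - x)]
  · linarith [min_le_right (x + lam) (lam - x)]

/-- The right component `(λ, ∞)` is exhausted by `(λ + λ/(n+2), (n+3)λ)`. [folklore] -/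
private theorem Ioi_subset_iUnion_right (hlam : 0 < lam) :
    Ioi lam ⊆ ⋃ n : ℕ, Ioo (lam + lam / (n + 2)) ((n + 3) * lam) := by
  intro x hx
  have hx' : 0 < x - lam := by simpa using hx
  obtain ⟨n, hn⟩ := exists_nat_gt (max (lam / (x - lam)) (x / lam))
  refine mem_iUnion.2 ⟨n, ?_⟩
  have hn2 : (0 : ℝ) < n + 2 := by positivity
  have h1 : lam / (x - lam) < n := (le_max_left _ _).trans_lt hn
  have h2 : x / lam < n := (le_max_right _ _).trans_lt hn
  rw [div_lt_iff₀ hx'] at h1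
  rw [div_lt_iff₀ hlam] at h2
  constructor
  · have : lam / (↑n + 2) < x - lam := by rw [div_lt_iff₀ hn2]; nlinarith
    linarith
  · nlinarith

/-- The left component `(−∞, −λ)` is exhausted by `(−(n+3)λ, −λ − λ/(n+2))`. [folklore] -/
private theorem Iio_subset_iUnion_left (hlam : 0 < lam) :
    Iio (-lam) ⊆ ⋃ n : ℕ, Ioo (-((n + 3) * lam)) (-lam - lam / (n + 2)) := by
  intro x hx
  have hx' : -x ∈ Ioi lam := by simp only [mem_Ioi]; rw [mem_Iio] at hx; linarith
  obtain ⟨n, hn⟩ := mem_iUnion.1 (Ioi_subset_iUnion_right hlam hx')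
  exact mem_iUnion.2 ⟨n, ⟨by linarith [hn.2], by linarith [hn.1]⟩⟩

/-- Trichotomy off `±λ`. [folklore] -/
private theorem mem_components_of_mem {x : ℝ} (hx : x ∈ {x : ℝ | x ≠ lam ∧ x ≠ -lam}) :
    x < -lam ∨ x ∈ Ioo (-lam) lam ∨ lam < x := by
  rcases lt_trichotomy x (-lam) with h | h | h
  · exact Or.inl h
  · exact absurd h hx.2
  · rcases lt_trichotomy x lam with h' | h' | h'
    · exact Or.inr (Or.inl ⟨h, h'⟩)
    · exact absurd h' hx.1
    · exact Or.inr (Or.inr h')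

/-- RH-FREE (PROVED). **The regular representative of a general `ξ ∈ dom W_max`** (`λ > 0`,
`η := W_max ξ ∈ L²(ℝ)` arbitrary): there is `g : ℝ → ℂ` with `ξ = g` a.e., `g ∈ C¹(ℝ ∖ {±λ})`, such
that on each component of `ℝ ∖ {±λ}` the function `p g′` is a primitive of `q g − η`
(`p(y)g′(y) − p(x)g′(x) = ∫_x^y (q g − η)` whenever `[x, y] ⊆ ℝ ∖ {±λ}`; in particular `p g′` is
locally absolutely continuous there with `(p g′)′ = q g − η` a.e., also recorded in `HasDerivAt` form),
and `p g′` has one-sided limits at `±λ` from each side (the boundary values of Lemma 1.2 (i)).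
This is the «`p∂ξ` is a function» step of the printed proof of Lemma 1.2, recorded for ALL of
`dom W_max` and all of `ℝ ∖ {±λ}` (the enabling lemma for Thm 1.6 (ii)–(iv) and Lemma 1.5).
[cite: ConnesMoscovici2022, proof of Lemma 1.2 (= arXiv Lemma 2.2, chunk p0004:L58–L90)] -/
theorem exists_regular_repr (hlam : 0 < lam) (ξ : (prolateMax lam).domain) :
    ∃ g : ℝ → ℂ, ((ξ : L2R) : ℝ → ℂ) =ᵐ[volume] g ∧
      ContDiffOn ℝ 1 g {x | x ≠ lam ∧ x ≠ -lam} ∧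
      (∀ x y, x ≤ y → Icc x y ⊆ {x | x ≠ lam ∧ x ≠ -lam} →
        pCoeff lam y * deriv g y - pCoeff lam x * deriv g x =
          ∫ t in x..y, (qCoeff lam t * g t - (prolateMax lam ξ : L2R) t)) ∧
      (∀ᵐ x, x ∈ {x : ℝ | x ≠ lam ∧ x ≠ -lam} →
        HasDerivAt (fun y ↦ pCoeff lam y * deriv g y)
          (qCoeff lam x * g x - (prolateMax lam ξ : L2R) x) x) ∧
      (∀ a ∈ ({lam, -lam} : Set ℝ),
        (∃ c, Tendsto (fun x ↦ pCoeff lam x * deriv g x) (𝓝[>] a) (𝓝 c)) ∧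
        (∃ c, Tendsto (fun x ↦ pCoeff lam x * deriv g x) (𝓝[<] a) (𝓝 c))) := by
  set U : Set ℝ := {x | x ≠ lam ∧ x ≠ -lam} with hUdef
  set hf : ℝ → ℂ := fun s ↦ qCoeff lam s * (ξ : L2R) s - (prolateMax lam ξ : L2R) s with hhf
  set F : ℝ → ℝ → ℂ := fun b x ↦ ∫ t in b..x, hf t with hF
  set Φ : ℝ → ℂ → ℂ → ℝ → ℂ := fun b m k x ↦ (∫ t in b..x, (F b t + m) / pCoeff lam t) + k with hΦ
  -- the three components, their exhaustions and constants
  set C₁ : Set ℝ := Iio (-lam) with hC₁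
  set C₂ : Set ℝ := Ioo (-lam) lam with hC₂
  set C₃ : Set ℝ := Ioi lam with hC₃
  have hC₁U : C₁ ⊆ U := fun x (hx : x < -lam) ↦ ⟨by linarith, by linarith⟩
  have hC₂U : C₂ ⊆ U := fun x hx ↦ ⟨hx.2.ne, hx.1.ne'⟩
  have hC₃U : C₃ ⊆ U := fun x (hx : lam < x) ↦ ⟨hx.ne', by linarith⟩
  -- left
  have hU₁ : ∀ n : ℕ, Icc (-((n + 3) * lam)) (-lam - lam / (n + 2)) ⊆ U := by
    intro n x hx
    have hn2 : (0 : ℝ) < lam / (n + 2) := by positivity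
    exact hC₁U (show x < -lam by linarith [hx.2])
  have hb₁ : ∀ n : ℕ, -(2 * lam) ∈ Ioo (-((n + 3) * lam)) (-lam - lam / (n + 2)) := by
    intro n
    have hn2 : (0 : ℝ) < (n : ℝ) + 2 := by positivity
    have h1 : lam / (n + 2) < lam := by
      rw [div_lt_iff₀ hn2]; nlinarith
    constructor <;> nlinarith
  obtain ⟨m₁, k₁, h₁⟩ := ae_eq_primitive_on_iUnion ξ hU₁ hb₁
  -- middle
  have hU₂ : ∀ n : ℕ, Icc (-lam + lam / (n + 2)) (lam - lam / (n + 2)) ⊆ U := by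
    intro n x hx
    have hn2 : (0 : ℝ) < lam / (n + 2) := by positivity
    exact hC₂U ⟨by linarith [hx.1], by linarith [hx.2]⟩
  have hb₂ : ∀ n : ℕ, (0 : ℝ) ∈ Ioo (-lam + lam / (n + 2)) (lam - lam / (n + 2)) := by
    intro n
    have hn2 : (0 : ℝ) < (n : ℝ) + 2 := by positivity
    have h1 : lam / (n + 2) < lam := by
      rw [div_lt_iff₀ hn2]; nlinarith
    constructor <;> linarith
  obtain ⟨m₂, k₂, h₂⟩ := ae_eq_primitive_on_iUnion ξ hU₂ hb₂
  -- right
  have hU₃ : ∀ n : ℕ, Icc (lam + lam / (n + 2)) ((n + 3) * lam) ⊆ U := by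
    intro n x hx
    have hn2 : (0 : ℝ) < lam / (n + 2) := by positivity
    exact hC₃U (show lam < x by linarith [hx.1])
  have hb₃ : ∀ n : ℕ, 2 * lam ∈ Ioo (lam + lam / (n + 2)) ((n + 3) * lam) := by
    intro n
    have hn2 : (0 : ℝ) < (n : ℝ) + 2 := by positivity
    have h1 : lam / (n + 2) < lam := by
      rw [div_lt_iff₀ hn2]; nlinarith
    constructor <;> nlinarith
  obtain ⟨m₃, k₃, h₃⟩ := ae_eq_primitive_on_iUnion ξ hU₃ hb₃
  -- a.e. agreement on each component
  have hae₁ : ∀ᵐ x ∂(volume.restrict C₁), ((ξ : L2R) : ℝ → ℂ) x = Φ (-(2 * lam)) m₁ k₁ x :=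
    ae_restrict_of_ae_restrict_of_subset (Iio_subset_iUnion_left hlam) h₁
  have hae₂ : ∀ᵐ x ∂(volume.restrict C₂), ((ξ : L2R) : ℝ → ℂ) x = Φ 0 m₂ k₂ x :=
    ae_restrict_of_ae_restrict_of_subset (Ioo_subset_iUnion_middle lam) h₂
  have hae₃ : ∀ᵐ x ∂(volume.restrict C₃), ((ξ : L2R) : ℝ → ℂ) x = Φ (2 * lam) m₃ k₃ x :=
    ae_restrict_of_ae_restrict_of_subset (Ioi_subset_iUnion_right hlam) h₃
  -- the representative
  set g : ℝ → ℂ := fun x ↦ if x < -lam then Φ (-(2 * lam)) m₁ k₁ x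
    else if x < lam then Φ 0 m₂ k₂ x else Φ (2 * lam) m₃ k₃ x with hg
  have hg₁ : EqOn g (Φ (-(2 * lam)) m₁ k₁) C₁ := fun x (hx : x < -lam) ↦ by simp [hg, hx]
  have hg₂ : EqOn g (Φ 0 m₂ k₂) C₂ := fun x hx ↦ by
    have : ¬ x < -lam := not_lt.2 hx.1.le
    simp [hg, this, hx.2]
  have hg₃ : EqOn g (Φ (2 * lam) m₃ k₃) C₃ := fun x (hx : lam < x) ↦ by
    have h1 : ¬ x < -lam := not_lt.2 (by linarith)
    have h2 : ¬ x < lam := not_lt.2 hx.le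
    simp [hg, h1, h2]
  -- regularity of the three pieces
  have hb₁C : -(2 * lam) ∈ C₁ := show -(2 * lam) < -lam by linarith
  have hb₂C : (0 : ℝ) ∈ C₂ := ⟨by linarith, hlam⟩
  have hb₃C : 2 * lam ∈ C₃ := show lam < 2 * lam by linarith
  obtain ⟨hcd₁, hpd₁⟩ := contDiffOn_primitive ξ isOpen_Iio ordConnected_Iio hC₁U hb₁C m₁ k₁
  obtain ⟨hcd₂, hpd₂⟩ := contDiffOn_primitive ξ isOpen_Ioo ordConnected_Ioo hC₂U hb₂C m₂ k₂
  obtain ⟨hcd₃, hpd₃⟩ := contDiffOn_primitive ξ isOpen_Ioi ordConnected_Ioi hC₃U hb₃C m₃ k₃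
  -- `p g′ = F_b + m` on each component
  have hpg₁ : ∀ x ∈ C₁, pCoeff lam x * deriv g x = F (-(2 * lam)) x + m₁ := by
    intro x hx
    rw [(hg₁.eventuallyEq_of_mem (isOpen_Iio.mem_nhds hx)).deriv_eq]
    exact hpd₁ x hx
  have hpg₂ : ∀ x ∈ C₂, pCoeff lam x * deriv g x = F 0 x + m₂ := by
    intro x hx
    rw [(hg₂.eventuallyEq_of_mem (isOpen_Ioo.mem_nhds hx)).deriv_eq]
    exact hpd₂ x hx
  have hpg₃ : ∀ x ∈ C₃, pCoeff lam x * deriv g x = F (2 * lam) x + m₃ := by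
    intro x hx
    rw [(hg₃.eventuallyEq_of_mem (isOpen_Ioi.mem_nhds hx)).deriv_eq]
    exact hpd₃ x hx
  -- `ξ = g` a.e.
  have hne₁ : ∀ᵐ x : ℝ, x ≠ lam := by simp [ae_iff, measure_singleton]
  have hne₂ : ∀ᵐ x : ℝ, x ≠ -lam := by simp [ae_iff, measure_singleton]
  have hae : ((ξ : L2R) : ℝ → ℂ) =ᵐ[volume] g := by
    have h1' := (ae_restrict_iff' measurableSet_Iio).1 hae₁
    have h2' := (ae_restrict_iff' measurableSet_Ioo).1 hae₂
    have h3' := (ae_restrict_iff' measurableSet_Ioi).1 hae₃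
    filter_upwards [h1', h2', h3', hne₁, hne₂] with x hx₁ hx₂ hx₃ hxl hxn
    rcases mem_components_of_mem ⟨hxl, hxn⟩ with hx | hx | hx
    · rw [hg₁ hx]; exact hx₁ hx
    · rw [hg₂ hx]; exact hx₂ hx
    · rw [hg₃ hx]; exact hx₃ hx
  -- the primitive identity `F_b y − F_b x = ∫_x^y (q g − η)`
  have hFsub : ∀ b x y, F b y - F b x =
      ∫ t in x..y, (qCoeff lam t * g t - (prolateMax lam ξ : L2R) t) := by
    intro b x y
    rw [hF]
    simp only
    rw [integral_interval_sub_left (intervalIntegrable_qMul_sub ξ b y)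
      (intervalIntegrable_qMul_sub ξ b x)]
    refine integral_congr_ae ?_
    filter_upwards [hae] with t ht _
    simp [ht]
  refine ⟨g, hae, ?_, ?_, ?_, ?_⟩
  · -- `C¹` off `±λ`
    intro x hx
    rcases mem_components_of_mem hx with h | h | h
    · exact ((hcd₁.contDiffAt (isOpen_Iio.mem_nhds h)).congr_of_eventuallyEq
        (hg₁.eventuallyEq_of_mem (isOpen_Iio.mem_nhds h))).contDiffWithinAt
    · exact ((hcd₂.contDiffAt (isOpen_Ioo.mem_nhds h)).congr_of_eventuallyEq
        (hg₂.eventuallyEq_of_mem (isOpen_Ioo.mem_nhds h))).contDiffWithinAt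
    · exact ((hcd₃.contDiffAt (isOpen_Ioi.mem_nhds h)).congr_of_eventuallyEq
        (hg₃.eventuallyEq_of_mem (isOpen_Ioi.mem_nhds h))).contDiffWithinAt
  · -- FTC form on a component
    intro x y hxy hI
    have hxU : x ∈ U := hI (left_mem_Icc.2 hxy)
    have hyU : y ∈ U := hI (right_mem_Icc.2 hxy)
    rcases mem_components_of_mem hxU with hx | hx | hx
    · have hy : y ∈ C₁ := by
        by_contra hy'
        have : -lam ∈ Icc x y := ⟨hx.le, not_lt.1 hy'⟩
        exact (hI this).2 rfl
      rw [hpg₁ x hx, hpg₁ y hy, ← hFsub]; ring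
    · have hy : y ∈ C₂ := by
        refine ⟨lt_of_lt_of_le hx.1 hxy, ?_⟩
        by_contra hy'
        have : lam ∈ Icc x y := ⟨hx.2.le, not_lt.1 hy'⟩
        exact (hI this).1 rfl
      rw [hpg₂ x hx, hpg₂ y hy, ← hFsub]; ring
    · have hy : y ∈ C₃ := lt_of_lt_of_le hx hxy
      rw [hpg₃ x hx, hpg₃ y hy, ← hFsub]; ring
  · -- a.e. `HasDerivAt` form (Lebesgue differentiation of `F_b`)
    have hLeb := LocallyIntegrable.ae_hasDerivAt_integral (locallyIntegrable_qMul_sub ξ)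
    filter_upwards [hLeb, hae] with x hx hξx
    intro hxU
    have key : ∀ (C : Set ℝ) (b : ℝ) (m : ℂ), IsOpen C → x ∈ C →
        (∀ z ∈ C, pCoeff lam z * deriv g z = F b z + m) →
        HasDerivAt (fun y ↦ pCoeff lam y * deriv g y)
          (qCoeff lam x * g x - (prolateMax lam ξ : L2R) x) x := by
      intro C b m hC hxC hpg
      have hev : (fun y ↦ F b y + m) =ᶠ[𝓝 x] (fun y ↦ pCoeff lam y * deriv g y) :=
        Filter.eventually_of_mem (hC.mem_nhds hxC) fun z hz ↦ (hpg z hz).symm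
      have h1 : HasDerivAt (fun y ↦ F b y + m) (hf x) x := (hx b).add_const m
      have h2 := h1.congr_of_eventuallyEq hev.symm
      have hval : hf x = qCoeff lam x * g x - (prolateMax lam ξ : L2R) x := by
        simp [hhf, hξx]
      rw [← hval]; exact h2
    rcases mem_components_of_mem hxU with h | h | h
    · exact key C₁ _ _ isOpen_Iio h hpg₁
    · exact key C₂ _ _ isOpen_Ioo h hpg₂
    · exact key C₃ _ _ isOpen_Ioi h hpg₃
  · -- one-sided limits of `p g′` at `±λ`
    have key : ∀ (S : Set ℝ) (a b : ℝ) (m : ℂ) (l : Filter ℝ), S ∈ l → l ≤ 𝓝 a →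
        (∀ z ∈ S, pCoeff lam z * deriv g z = F b z + m) →
        ∃ c, Tendsto (fun x ↦ pCoeff lam x * deriv g x) l (𝓝 c) := by
      intro S a b m l hS hl hpg
      refine ⟨F b a + m, ?_⟩
      have h1 : Tendsto (fun x ↦ F b x + m) l (𝓝 (F b a + m)) :=
        (((continuous_primitive_qMul_sub ξ b).tendsto a).add_const m).mono_left hl
      exact h1.congr' (Filter.eventually_of_mem hS fun z hz ↦ (hpg z hz).symm)
    have hll : -lam < lam := by linarith
    intro a ha
    rcases ha with rfl | rfl
    · exact ⟨key C₃ _ _ _ _ self_mem_nhdsWithin nhdsWithin_le_nhds hpg₃,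
        key C₂ _ _ _ _ (Ioo_mem_nhdsLT hll) nhdsWithin_le_nhds hpg₂⟩
    · exact ⟨key C₂ _ _ _ _ (Ioo_mem_nhdsGT hll) nhdsWithin_le_nhds hpg₂,
        key C₁ _ _ _ _ self_mem_nhdsWithin nhdsWithin_le_nhds hpg₁⟩

end Global

end Literature.NumberTheory.ConnesMoscovici2022
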